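import Summits.MatrixMultiplication.MatrixMultiplication.Theorems.AbelianSTPPCensusU11GPrime
import Summits.MatrixMultiplication.MatrixMultiplication.Theorems.AbelianSTPPCensusVPHereditary
import Summits.MatrixMultiplication.MatrixMultiplication.Theorems.AbelianSTPPCensusTALin1200Sound

/-!
# Rule U11-G′: the device-facing toolbox — heredity (node rule) and the Grynkiewicz–Wang budget forms

Cell mm-stpp (rung F-M1), PRE-REG v1 band B3 (seat mm-stpp-theory, gen 13).  What the census device's certificate checkers consume from a
U11-type rule, re-issued for `U11GPrime` (`AbelianSTPPCensusU11GPrime.lean`, Grynkiewicz–Wang floor `⌊(4t² − 2t)/3⌋`):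

* HEREDITY (prefix pruning is sound): `u11GPrimeFormB_comp`, `u11GPrime_comp` — the rule passes from a shape list with the packing
  inequalities `P_AB, P_BC, P_CA ≤ M` to every sub-list `(a ∘ φ, b ∘ φ, c ∘ φ)`, `φ : Fin K ↪ Fin N` (verbatim the argument of
  `VPRules.u11GFormB_comp`: floor and fibre budget monotone, ceiling antitone `VPRules.ubB_le_ubB_comp`, the constant unchanged);
* BUDGET FORMS (the linear / static certificates' per-member inequality): `budget_formGW` — if form B holds for the letters `(x,y,z)`,
  `P_CA ≤ M`, and member `l` has `y_l < t ≤ y_l·min(x_l, z_l)` with `t ≥ 2`, then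
  `t·(P_AB + P_BC + P_CA) ≤ Σ_i x_i y_i z_i + t·M + ⌊(4t² − 2t)/3⌋` (cf. `TALin1200.budget_form` / `TAStat.budget_form'` with `+ 1 ≤ … + 2t²`);
  letter versions `gw_budget_A/_B/_C` from `SieveAdmissible ∧ U11GPrime` (cf. `TAStat.grynkiewicz_budget'_A/B/C`).
The saving against U11-G at the same `t` is `2t² − 1 − ⌊(4t²−2t)/3⌋ = ⌈(2t² + 2t)/3⌉ − 1` units of budget.
WHAT THIS IS NOT: arithmetic on the typed rule only — no STPP family, no census number, no `ω` statement.
-/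

set_option linter.dupNamespace false -- `MatrixMultiplication.MatrixMultiplication` (summit = problem, D-0017)
set_option autoImplicit false

namespace Summit.MatrixMultiplication.MatrixMultiplication.Theorems

namespace U11GPrimeTools

open Finset VPRules

variable {N K M : ℕ}

/-! ### Heredity -/

/-- **Rule U11-G′ (form B) is hereditary**: it passes from a shape list with `P_CA ≤ M` to every sub-list. [original] -/
theorem u11GPrimeFormB_comp (φ : Fin K ↪ Fin N) {a b c : Fin N → ℕ} (hCA : pCA a b c ≤ M)
    (h : U11GPrimeFormB M a b c) : U11GPrimeFormB M (a ∘ φ) (b ∘ φ) (c ∘ φ) := by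
  intro t ht2 htAB htBC htL
  have hAB := pAB_comp_le φ a b c
  have hBC := pBC_comp_le φ a b c
  have hU := ubB_le_ubB_comp φ hCA t
  have key := h t ht2 (htAB.trans hAB) (htBC.trans hBC) (htL.trans (lB_comp_le φ a b c t))
  nlinarith

/-- **Rule U11-G′ (three letter forms) is hereditary** on lists satisfying the packing inequalities `P_AB, P_BC, P_CA ≤ M` (true for every
`SieveAdmissible` list and every STPP shape list). [original] -/
theorem u11GPrime_comp (φ : Fin K ↪ Fin N) {a b c : Fin N → ℕ} (hAB : pAB a b c ≤ M)
    (hBC : pBC a b c ≤ M) (hCA : pCA a b c ≤ M) (h : U11GPrime M a b c) :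
    U11GPrime M (a ∘ φ) (b ∘ φ) (c ∘ φ) := by
  obtain ⟨hB, hA, hC⟩ := h
  refine ⟨u11GPrimeFormB_comp φ hCA hB, u11GPrimeFormB_comp φ ?_ hA, u11GPrimeFormB_comp φ ?_ hC⟩
  · unfold pCA; unfold pBC at hBC; exact hBC
  · unfold pCA; unfold pAB at hAB; exact hAB

/-- A sub-list of a `SieveAdmissible ∧ U11GPrime` list is `U11GPrime` (packing from `SieveAdmissible`). [original] -/
theorem u11GPrime_comp_of_sieveAdmissible (φ : Fin K ↪ Fin N) {a b c : Fin N → ℕ} (hS : SieveAdmissible M a b c)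
    (h : U11GPrime M a b c) : U11GPrime M (a ∘ φ) (b ∘ φ) (c ∘ φ) := by
  obtain ⟨-, -, ⟨uab, ubc, uca⟩, -⟩ := hS
  exact u11GPrime_comp φ (by simpa [pAB] using uab) (by simpa [pBC] using ubc) (by simpa [pCA] using uca) h

/-! ### Budget forms -/

/-- **Grynkiewicz–Wang budget, one letter form.**  If form B of U11-G′ holds for the letters `(x,y,z)` at order `M`, `P_CA ≤ M`, and the member
`l` has `y_l < t ≤ y_l · min(x_l, z_l)` with `t ≥ 2` (so `P_AB, P_BC ≥ t` and `L_B(t) ≥ t` are witnessed by `l` alone), then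
`t·(P_AB + P_BC + P_CA) ≤ Σ_i x_i y_i z_i + t·M + ⌊(4t² − 2t)/3⌋` (the ceiling by `TALin1200.ubB_le`). [original] -/
theorem budget_formGW {x y z : Fin N → ℕ} (hF : U11GPrimeFormB M x y z) (hP : pCA x y z ≤ M) (l : Fin N) {t : ℕ}
    (hyt : y l < t) (ht : t ≤ y l * min (x l) (z l)) (ht2 : 2 ≤ t) :
    t * (pAB x y z + pBC x y z + pCA x y z) ≤ (∑ i, x i * y i * z i) + t * M + (4 * t * t - 2 * t) / 3 := by
  have hpab : t ≤ pAB x y z := by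
    calc t ≤ y l * min (x l) (z l) := ht
      _ ≤ y l * x l := Nat.mul_le_mul_left _ (min_le_left _ _)
      _ = x l * y l := by ring
      _ ≤ pAB x y z := Finset.single_le_sum (f := fun i => x i * y i) (fun i _ => Nat.zero_le _) (Finset.mem_univ l)
  have hpbc : t ≤ pBC x y z := by
    calc t ≤ y l * min (x l) (z l) := ht
      _ ≤ y l * z l := Nat.mul_le_mul_left _ (min_le_right _ _)
      _ ≤ pBC x y z := Finset.single_le_sum (f := fun i => y i * z i) (fun i _ => Nat.zero_le _) (Finset.mem_univ l)
  have hlb : t ≤ lB x y z t := by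
    calc t ≤ y l * min (x l) (z l) := ht
      _ = (if y l < t then y l * min (x l) (z l) else 0) := by rw [if_pos hyt]
      _ ≤ lB x y z t := Finset.single_le_sum (f := fun i => if y i < t then y i * min (x i) (z i) else 0)
          (fun i _ => Nat.zero_le _) (Finset.mem_univ l)
  have key := hF t ht2 hpab hpbc hlb
  have hub := TALin1200.ubB_le (M := M) x y z t
  have hsub : t * (M - pCA x y z) + t * pCA x y z = t * M := by rw [← Nat.mul_add, Nat.sub_add_cancel hP]
  have e1 : t * (pAB x y z + pBC x y z + pCA x y z) = t * pAB x y z + t * pBC x y z + t * pCA x y z := by ring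
  have e2 : t * (pAB x y z + pBC x y z) = t * pAB x y z + t * pBC x y z := by ring
  rw [e1]; rw [e2] at key
  omega

/-- **Grynkiewicz–Wang budget, letter `b` smallest** (`b_l < t ≤ b_l · min(a_l, c_l)`). [original] -/
theorem gw_budget_B {a b c : Fin N → ℕ} (hS : SieveAdmissible M a b c) (hG : U11GPrime M a b c) (l : Fin N) {t : ℕ}
    (hyt : b l < t) (ht : t ≤ b l * min (a l) (c l)) (ht2 : 2 ≤ t) :
    t * (∑ i, (a i * b i + b i * c i + c i * a i)) ≤ (∑ i, a i * b i * c i) + t * M + (4 * t * t - 2 * t) / 3 := by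
  obtain ⟨-, -, ⟨-, -, uca⟩, -⟩ := hS
  have h := budget_formGW hG.1 (by simpa [pCA] using uca) l hyt ht ht2
  rw [TALin1200.sum_us_eq]; exact h

/-- **Grynkiewicz–Wang budget, letter `a` smallest** (form A = letters `(c,a,b)`; `a_l < t ≤ a_l · min(c_l, b_l)`). [original] -/
theorem gw_budget_A {a b c : Fin N → ℕ} (hS : SieveAdmissible M a b c) (hG : U11GPrime M a b c) (l : Fin N) {t : ℕ}
    (hyt : a l < t) (ht : t ≤ a l * min (c l) (b l)) (ht2 : 2 ≤ t) :
    t * (∑ i, (a i * b i + b i * c i + c i * a i)) ≤ (∑ i, a i * b i * c i) + t * M + (4 * t * t - 2 * t) / 3 := by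
  obtain ⟨-, -, ⟨-, ubc, -⟩, -⟩ := hS
  have h := budget_formGW hG.2.1 (by simpa [pCA] using ubc) l hyt ht ht2
  have e1 : pAB c a b + pBC c a b + pCA c a b = pAB a b c + pBC a b c + pCA a b c := by
    simp only [pAB, pBC, pCA]; ring
  have e2 : ∑ i, c i * a i * b i = ∑ i, a i * b i * c i := Finset.sum_congr rfl fun i _ => by ring
  rw [e1, e2] at h
  rw [TALin1200.sum_us_eq]; exact h

/-- **Grynkiewicz–Wang budget, letter `c` smallest** (form C = letters `(b,c,a)`; `c_l < t ≤ c_l · min(b_l, a_l)`). [original] -/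
theorem gw_budget_C {a b c : Fin N → ℕ} (hS : SieveAdmissible M a b c) (hG : U11GPrime M a b c) (l : Fin N) {t : ℕ}
    (hyt : c l < t) (ht : t ≤ c l * min (b l) (a l)) (ht2 : 2 ≤ t) :
    t * (∑ i, (a i * b i + b i * c i + c i * a i)) ≤ (∑ i, a i * b i * c i) + t * M + (4 * t * t - 2 * t) / 3 := by
  obtain ⟨-, -, ⟨uab, -, -⟩, -⟩ := hS
  have h := budget_formGW hG.2.2 (by simpa [pCA] using uab) l hyt ht ht2
  have e1 : pAB b c a + pBC b c a + pCA b c a = pAB a b c + pBC a b c + pCA a b c := by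
    simp only [pAB, pBC, pCA]; ring
  have e2 : ∑ i, b i * c i * a i = ∑ i, a i * b i * c i := Finset.sum_congr rfl fun i _ => by ring
  rw [e1, e2] at h
  rw [TALin1200.sum_us_eq]; exact h

end U11GPrimeTools

end Summit.MatrixMultiplication.MatrixMultiplication.Theorems
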